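import Summits.AtomisticToContinuum.HydrodynamicLimit.Theses.AntiMazurCoboundaries
import Literature.MathematicalPhysics.KineticTheory.HardSphereEulerProofs

/-!
# Statics: odd/even product sums on product Gaussians; the velocity marginal of the Gibbs law (helper file 3/7)

`integral_sum_mul_sum`: `∫ (Σᵢ a(vᵢ))(Σⱼ b(vⱼ)) d(⊗ⁿμ) = n ∫ a b dμ` for `a` odd and `μ` reflection-invariant (flip one
particle: cross terms vanish). `map_velOf_localGibbsLaw`: for `σ ≤ 1/2` the velocity marginal of the constant-profile
local Gibbs law is `⊗ stdGaussian` (disintegration `lintegral_localGibbsMeasure`, positions integrate to `1`).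
refuter-cdisprove-stmt-AtomisticToContinuum-13985-0 (crux BoltzmannGreenKubo, stmt-13985; infrastructure of the Mazur-floor refutation `Negative/OrthMomentum.lean`, see `Cruxes/BoltzmannGreenKubo/Disproof.lean` §1d–§1h).
-/

noncomputable section

namespace Summit.AtomisticToContinuum.HydrodynamicLimit.Theorems

open MeasureTheory ProbabilityTheory Filter Topology Set
open Literature.Analysis.FluidPDE Literature.MathematicalPhysics.KineticTheory
open Literature.Analysis.UnboundedOperators
open scoped InnerProductSpace

namespace BoltzmannGreenKuboOrthMomentum

section PiStatics

variable {n : ℕ}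

/-- Flip the velocity of particle `i` (a measurable involution of `(ℝ³)ⁿ`). [folklore] -/
def flipAt (i : Fin n) : (Fin n → V3) ≃ᵐ (Fin n → V3) :=
  MeasurableEquiv.piCongrRight fun k => if k = i then MeasurableEquiv.neg V3 else MeasurableEquiv.refl V3

/-- Helper for the Mazur-floor refutation (see the module docstring). [folklore] -/
theorem flipAt_apply (i : Fin n) (v : Fin n → V3) (k : Fin n) :
    flipAt i v k = if k = i then -v k else v k := by
  show (if k = i then MeasurableEquiv.neg V3 else MeasurableEquiv.refl V3) (v k) = _
  split_ifs <;> rfl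

/-- The flip preserves every product of a reflection-invariant one-particle law. [folklore] -/
theorem measurePreserving_flipAt (μ : Measure V3) [SigmaFinite μ]
    (hμ : MeasurePreserving (fun v : V3 => -v) μ μ) (i : Fin n) :
    MeasurePreserving (flipAt i) (Measure.pi fun _ : Fin n => μ) (Measure.pi fun _ : Fin n => μ) := by
  have h := measurePreserving_pi (fun _ : Fin n => μ) (fun _ : Fin n => μ)
    (f := fun k => ⇑(if k = i then MeasurableEquiv.neg V3 else MeasurableEquiv.refl V3))
    (fun k => by
      by_cases hk : k = i
      · subst hk
        simp only [if_true]
        exact hμ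
      · simp only [hk, if_false]
        exact MeasurePreserving.id _)
  exact h

/-- **Cross terms vanish**: for `i ≠ j`, `∫ a(vᵢ) b(vⱼ) = 0` on a product of reflection-invariant laws when
`a` is odd (flip particle `i`). [folklore] -/
theorem integral_cross_eq_zero (μ : Measure V3) [SigmaFinite μ]
    (hμ : MeasurePreserving (fun v : V3 => -v) μ μ) (a b : V3 → ℝ) (ha : ∀ v, a (-v) = -a v)
    {i j : Fin n} (hij : i ≠ j) :
    ∫ v, a (v i) * b (v j) ∂(Measure.pi fun _ : Fin n => μ) = 0 := by
  have h1 := (measurePreserving_flipAt μ hμ i).integral_comp (flipAt i).measurableEmbedding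
    (fun v : Fin n → V3 => a (v i) * b (v j))
  have h2 : (fun v : Fin n → V3 => a (flipAt i v i) * b (flipAt i v j)) =
      fun v => -(a (v i) * b (v j)) := by
    funext v
    rw [flipAt_apply, flipAt_apply, if_pos rfl, if_neg (Ne.symm hij), ha]
    ring
  rw [h2, integral_neg] at h1
  linarith

/-- **Diagonal terms**: `∫ c(vᵢ) d(⊗μ) = ∫ c dμ` for a product of probability laws. [folklore] -/
theorem integral_diag (μ : Measure V3) [IsProbabilityMeasure μ] (c : V3 → ℝ) (hc : Measurable c)
    (i : Fin n) : ∫ v, c (v i) ∂(Measure.pi fun _ : Fin n => μ) = ∫ w, c w ∂μ := by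
  have h := measurePreserving_eval (fun _ : Fin n => μ) i
  calc ∫ v, c (v i) ∂(Measure.pi fun _ : Fin n => μ)
      = ∫ w, c w ∂((Measure.pi fun _ : Fin n => μ).map (Function.eval i)) :=
        (integral_map (measurable_pi_apply i).aemeasurable hc.aestronglyMeasurable).symm
    _ = ∫ w, c w ∂μ := by rw [h.map_eq]

/-- **Odd/even product sums**: `∫ (Σᵢ a(vᵢ))(Σⱼ b(vⱼ)) d(⊗ⁿμ) = n ∫ a b dμ` when `a` is odd and `μ` is
reflection-invariant (only diagonal terms survive). [folklore] -/
theorem integral_sum_mul_sum (μ : Measure V3) [IsProbabilityMeasure μ]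
    (hμ : MeasurePreserving (fun v : V3 => -v) μ μ) (a b : V3 → ℝ) (ha : ∀ v, a (-v) = -a v)
    (hameas : Measurable a) (hbmeas : Measurable b)
    (hab : ∀ i j : Fin n, Integrable (fun v : Fin n → V3 => a (v i) * b (v j)) (Measure.pi fun _ : Fin n => μ)) :
    ∫ v, (∑ i, a (v i)) * (∑ j, b (v j)) ∂(Measure.pi fun _ : Fin n => μ) = n * ∫ w, a w * b w ∂μ := by
  simp_rw [Finset.sum_mul_sum]
  rw [integral_finsetSum _ (fun i _ => integrable_finsetSum _ (fun j _ => hab i j))]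
  have hi : ∀ i : Fin n, ∫ v, ∑ j, a (v i) * b (v j) ∂(Measure.pi fun _ : Fin n => μ) = ∫ w, a w * b w ∂μ := by
    intro i
    rw [integral_finsetSum _ (fun j _ => hab i j)]
    rw [Finset.sum_eq_single i (fun j _ hji => integral_cross_eq_zero μ hμ a b ha (Ne.symm hji))
      (fun h => (h (Finset.mem_univ i)).elim)]
    exact integral_diag μ (fun w => a w * b w) (hameas.mul hbmeas) i
  simp only [hi, Finset.sum_const, Finset.card_univ, Fintype.card_fin, nsmul_eq_mul]

end PiStatics

section VelocityMarginal

/-- `gaussMeasure 0 1` is the standard Gaussian. [folklore] -/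
theorem gaussMeasure_zero_one : gaussMeasure (0 : V3) 1 = stdGaussian V3 := by
  rw [gaussMeasure]
  have : (fun w : V3 => (0 : V3) + Real.sqrt 1 • w) = id := by
    funext w
    simp
  rw [this, Measure.map_id]

/-- The standard Gaussian is reflection-invariant. [folklore] -/
theorem measurePreserving_neg_stdGaussian :
    MeasurePreserving (fun v : V3 => -v) (stdGaussian V3) (stdGaussian V3) := by
  refine ⟨measurable_neg, ?_⟩
  have h := stdGaussian_map (LinearIsometryEquiv.neg ℝ (E := V3))
  simpa [LinearIsometryEquiv.coe_neg] using h

/-- The velocity projection of a configuration. [folklore] -/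
def velOf {N : ℕ} (z : Config N (Fin 3) T3) : Fin N → V3 := fun i => (z i).2

/-- Helper for the Mazur-floor refutation (see the module docstring). [folklore] -/
theorem measurable_velOf {N : ℕ} : Measurable (velOf : Config N (Fin 3) T3 → Fin N → V3) :=
  measurable_pi_lambda _ fun i => (measurable_pi_apply i).snd

/-- Helper for the Mazur-floor refutation (see the module docstring). [folklore] -/
theorem velOf_zipConfig {N : ℕ} (x : Fin N → T3) (v : Fin N → V3) : velOf (zipConfig (x, v)) = v := by
  funext i
  simp [velOf]

/-- **The velocity marginal of the constant-profile local Gibbs law is the product standard Gaussian**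
(`σ ≤ 1/2`: the positions integrate out to `1`). [folklore] -/
theorem map_velOf_localGibbsLaw {σ : ℝ} (hσ : σ ≤ 1 / 2) (N : ℕ)
    (Φ : HardSphereFlow (Torus.geometry (Fin 3)) (hsDiameter σ N) (N + 1)) :
    (localGibbsLaw σ (fun _ => 1) (fun _ => 0) (fun _ => 1) N Φ).map velOf =
      Measure.pi fun _ : Fin (N + 1) => stdGaussian V3 := by
  haveI : IsProbabilityMeasure (localGibbsMeasure σ (fun _ => (1 : ℝ)) (fun _ => (0 : V3)) (fun _ => (1 : ℝ)) N) :=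
    isProbabilityMeasure_localGibbsMeasure continuous_const continuous_const continuous_const
      (fun _ => one_pos) (fun _ => one_pos) hσ N
  rw [localGibbsLaw_eq]
  ext B hB
  rw [Measure.map_apply measurable_velOf hB, ← lintegral_indicator_one (hB.preimage measurable_velOf)]
  have hG : Measurable fun z : Config (N + 1) (Fin 3) T3 =>
      (velOf ⁻¹' B).indicator (1 : Config (N + 1) (Fin 3) T3 → ENNReal) z :=
    measurable_one.indicator (hB.preimage measurable_velOf)
  rw [lintegral_localGibbsMeasure continuous_const continuous_const continuous_const (fun _ => zero_le_one)
    (fun _ => one_pos) σ N hG]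
  have hin : ∀ (x : Fin (N + 1) → T3),
      ∫⁻ v, (velOf ⁻¹' B).indicator (1 : Config (N + 1) (Fin 3) T3 → ENNReal) (zipConfig (x, v))
          ∂velMeasure (fun _ => (0 : V3)) (fun _ => (1 : ℝ)) x
        = (Measure.pi fun _ : Fin (N + 1) => stdGaussian V3) B := by
    intro x
    have hv : velMeasure (fun _ => (0 : V3)) (fun _ => (1 : ℝ)) x = Measure.pi fun _ : Fin (N + 1) => stdGaussian V3 := by
      simp only [velMeasure, gaussMeasure_zero_one]
    have hind : (fun v => (velOf ⁻¹' B).indicator (1 : Config (N + 1) (Fin 3) T3 → ENNReal) (zipConfig (x, v))) =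
        B.indicator (1 : (Fin (N + 1) → V3) → ENNReal) := by
      funext v
      simp only [Set.indicator, Set.mem_preimage, velOf_zipConfig]
      rfl
    rw [hind, lintegral_indicator_one hB, hv]
  simp only [hin]
  rw [lintegral_mul_const' _ _ (measure_ne_top _ _),
    lintegral_posWeight_eq_one continuous_const continuous_const continuous_const (fun _ => zero_le_one)
      (fun _ => one_pos) σ N, one_mul]

/-- Velocity-only observables are integrated against the product standard Gaussian. [folklore] -/
theorem integral_velOf_localGibbsLaw {σ : ℝ} (hσ : σ ≤ 1 / 2) (N : ℕ)
    (Φ : HardSphereFlow (Torus.geometry (Fin 3)) (hsDiameter σ N) (N + 1))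
    {H : (Fin (N + 1) → V3) → ℝ} (hH : Measurable H) :
    ∫ z, H (velOf z) ∂(localGibbsLaw σ (fun _ => 1) (fun _ => 0) (fun _ => 1) N Φ) =
      ∫ v, H v ∂(Measure.pi fun _ : Fin (N + 1) => stdGaussian V3) := by
  rw [← map_velOf_localGibbsLaw hσ N Φ, integral_map measurable_velOf.aemeasurable hH.aestronglyMeasurable]

/-- … and likewise for integrability. [folklore] -/
theorem integrable_velOf_localGibbsLaw {σ : ℝ} (hσ : σ ≤ 1 / 2) (N : ℕ)
    (Φ : HardSphereFlow (Torus.geometry (Fin 3)) (hsDiameter σ N) (N + 1))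
    {H : (Fin (N + 1) → V3) → ℝ}
    (hint : Integrable H (Measure.pi fun _ : Fin (N + 1) => stdGaussian V3)) :
    Integrable (fun z => H (velOf z)) (localGibbsLaw σ (fun _ => 1) (fun _ => 0) (fun _ => 1) N Φ) := by
  rw [← map_velOf_localGibbsLaw hσ N Φ] at hint
  exact hint.comp_measurable measurable_velOf

end VelocityMarginal


end BoltzmannGreenKuboOrthMomentum

end Summit.AtomisticToContinuum.HydrodynamicLimit.Theorems

end
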